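import Mathlib

/-!
# No exact landing (or lift-off) at finite `n` — kernel #109 (solo-blind, s60)

Paper §24.59(5)–§24.60 (window lemma, F-series).  In the finite-`n` reduced model the pattern
envelope `a` on the leaf-label axis satisfies the envelope equation

  `γ h² a'' + W a = 0`,  `W = max(S + s₀ u + b μ - κ μ², -K₀) - g a²`,

a second-order equation that is LINEAR in `a` once the bounded coefficient
`k(x) := -W(x)/(γ h²)` is frozen along the solution.  Consequently Cauchy data `a = a' = 0` at one
point force `a ≡ 0` on the whole interval: a solution that is positive somewhere on the live
interval can neither land exactly (`a(xₑ) = a'(xₑ) = 0`) nor lift off exactly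
(`a(x₀) = a'(x₀) = 0`) at a finite point.  At finite `n` every member of the computed family
therefore carries tails beyond both contacts; the "jump-free landing" of the design is the
`n → ∞` contact profile `a ∝ (xₑ - x)²₊` that the tuned members approach (misfit `Φ ∝ n^{-1.3}`,
§24.60(3)), and the frozen-dial members on BOTH sides of the sliver overshoot the neutral leaf
(§24.60(5)): there is no "undershooting" branch that stops short of `xₑ` with compact support.

Statements (pure real analysis, Mathlib only; `k` is any coefficient bounded on the interval —
no continuity or sign is needed, so the lemma applies verbatim to the nonlinear `W` above
evaluated along a given `C¹` state):

* `envelope_eq_zero_of_cauchy_right` — `|k| ≤ M` on `[x₁, x₂]`, `a' = da`, `da' = k·a` on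
  `[x₁, x₂]`, `a x₁ = da x₁ = 0` ⇒ `a = 0` and `da = 0` on `[x₁, x₂]` (Grönwall on `(a, da)`);
* `envelope_eq_zero_of_cauchy_left` — the same with the Cauchy data at the right end `x₂`
  (by the reflection `x ↦ -x`);
* `no_exact_liftoff`, `no_exact_landing` — if `a > 0` at some point of the interval then the
  Cauchy data cannot vanish at the left end, resp. at the right end.
-/

namespace Summit.AnomalousDissipation.AnomalousDissipation.Theorems

open Set

/-- Unique continuation from the LEFT endpoint for `a'' = k a` with a bounded coefficient:
zero Cauchy data at `x₁` force `a ≡ 0`, `a' ≡ 0` on `[x₁, x₂]`. -/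
theorem envelope_eq_zero_of_cauchy_right
    {k a da : ℝ → ℝ} {x₁ x₂ M : ℝ}
    (hk : ∀ x ∈ Icc x₁ x₂, |k x| ≤ M)
    (ha : ∀ x ∈ Icc x₁ x₂, HasDerivAt a (da x) x)
    (hda : ∀ x ∈ Icc x₁ x₂, HasDerivAt da (k x * a x) x)
    (h₁ : a x₁ = 0) (h₁' : da x₁ = 0) :
    ∀ x ∈ Icc x₁ x₂, a x = 0 ∧ da x = 0 := by
  -- the first-order system for `f = (a, da)`
  set f : ℝ → ℝ × ℝ := fun x => (a x, da x) with hf_def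
  set f' : ℝ → ℝ × ℝ := fun x => (da x, k x * a x) with hf'_def
  have hderiv : ∀ x ∈ Icc x₁ x₂, HasDerivAt f (f' x) x := fun x hx =>
    (ha x hx).prodMk (hda x hx)
  have hcont : ContinuousOn f (Icc x₁ x₂) := fun x hx =>
    (hderiv x hx).continuousAt.continuousWithinAt
  have hderiv' : ∀ x ∈ Ico x₁ x₂, HasDerivWithinAt f (f' x) (Ici x) x := fun x hx =>
    (hderiv x (Ico_subset_Icc_self hx)).hasDerivWithinAt
  have hzero : f x₁ = 0 := by
    simp [hf_def, h₁, h₁']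
  have hbound : ∀ x ∈ Ico x₁ x₂, ‖f' x‖ ≤ max 1 M * ‖f x‖ := by
    intro x hx
    have hxI : x ∈ Icc x₁ x₂ := Ico_subset_Icc_self hx
    have hn : ‖f x‖ = max |a x| |da x| := by
      simp [hf_def, Prod.norm_def, Real.norm_eq_abs]
    have hn' : ‖f' x‖ = max |da x| |k x * a x| := by
      simp [hf'_def, Prod.norm_def, Real.norm_eq_abs]
    have hfa : |a x| ≤ ‖f x‖ := by rw [hn]; exact le_max_left _ _
    have hfda : |da x| ≤ ‖f x‖ := by rw [hn]; exact le_max_right _ _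
    have hf0 : 0 ≤ ‖f x‖ := norm_nonneg _
    have h1 : |da x| ≤ max 1 M * ‖f x‖ := by
      calc |da x| ≤ ‖f x‖ := hfda
        _ = 1 * ‖f x‖ := (one_mul _).symm
        _ ≤ max 1 M * ‖f x‖ := mul_le_mul_of_nonneg_right (le_max_left _ _) hf0
    have h2 : |k x * a x| ≤ max 1 M * ‖f x‖ := by
      rw [abs_mul]
      calc |k x| * |a x| ≤ M * ‖f x‖ :=
            mul_le_mul (hk x hxI) hfa (abs_nonneg _) ((abs_nonneg _).trans (hk x hxI))
        _ ≤ max 1 M * ‖f x‖ := mul_le_mul_of_nonneg_right (le_max_right _ _) hf0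
    rw [hn']
    exact max_le h1 h2
  have hz := eq_zero_of_abs_deriv_le_mul_abs_self_of_eq_zero_right hcont hderiv' hzero hbound
  intro x hx
  have hx0 : f x = 0 := hz x hx
  have : (a x, da x) = (0, 0) := by simpa [hf_def] using hx0
  exact ⟨(Prod.mk.injEq _ _ _ _).mp this |>.1, (Prod.mk.injEq _ _ _ _).mp this |>.2⟩

/-- Unique continuation from the RIGHT endpoint (reflection `x ↦ -x` of the previous lemma):
zero Cauchy data at `x₂` force `a ≡ 0`, `a' ≡ 0` on `[x₁, x₂]`. -/
theorem envelope_eq_zero_of_cauchy_left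
    {k a da : ℝ → ℝ} {x₁ x₂ M : ℝ}
    (hk : ∀ x ∈ Icc x₁ x₂, |k x| ≤ M)
    (ha : ∀ x ∈ Icc x₁ x₂, HasDerivAt a (da x) x)
    (hda : ∀ x ∈ Icc x₁ x₂, HasDerivAt da (k x * a x) x)
    (h₂ : a x₂ = 0) (h₂' : da x₂ = 0) :
    ∀ x ∈ Icc x₁ x₂, a x = 0 ∧ da x = 0 := by
  -- reflected functions on `[-x₂, -x₁]`
  have hmem : ∀ y ∈ Icc (-x₂) (-x₁), -y ∈ Icc x₁ x₂ := fun y hy =>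
    ⟨by linarith [hy.2], by linarith [hy.1]⟩
  have hb : ∀ y ∈ Icc (-x₂) (-x₁),
      HasDerivAt (fun y => a (-y)) ((fun y => -da (-y)) y) y := by
    intro y hy
    have h := (ha (-y) (hmem y hy)).comp y (hasDerivAt_neg y)
    have h' : HasDerivAt (fun y => a (-y)) (da (-y) * -1) y := h
    simpa using h'
  have hdb : ∀ y ∈ Icc (-x₂) (-x₁),
      HasDerivAt (fun y => -da (-y)) ((fun y => k (-y)) y * (fun y => a (-y)) y) y := by
    intro y hy
    have h := (hda (-y) (hmem y hy)).comp y (hasDerivAt_neg y)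
    have h' : HasDerivAt (fun y => da (-y)) (k (-y) * a (-y) * -1) y := h
    have h'' : HasDerivAt (fun y => -da (-y)) (-(k (-y) * a (-y) * -1)) y := h'.neg
    have e : -(k (-y) * a (-y) * -1) = k (-y) * a (-y) := by ring
    rw [e] at h''
    exact h''
  have hk' : ∀ y ∈ Icc (-x₂) (-x₁), |(fun y => k (-y)) y| ≤ M := fun y hy => hk (-y) (hmem y hy)
  have hz := envelope_eq_zero_of_cauchy_right (k := fun y => k (-y)) (a := fun y => a (-y))
    (da := fun y => -da (-y)) (x₁ := -x₂) (x₂ := -x₁) (M := M) hk' hb hdb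
    (by simpa using h₂) (by simpa using h₂')
  intro x hx
  have hy : -x ∈ Icc (-x₂) (-x₁) := ⟨by linarith [hx.2], by linarith [hx.1]⟩
  have h := hz (-x) hy
  simp only [neg_neg, neg_eq_zero] at h
  exact h

/-- No exact lift-off: an envelope that is positive somewhere on `[x₁, x₂]` cannot have
`a(x₁) = a'(x₁) = 0`. -/
theorem no_exact_liftoff
    {k a da : ℝ → ℝ} {x₁ x₂ M : ℝ}
    (hk : ∀ x ∈ Icc x₁ x₂, |k x| ≤ M)
    (ha : ∀ x ∈ Icc x₁ x₂, HasDerivAt a (da x) x)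
    (hda : ∀ x ∈ Icc x₁ x₂, HasDerivAt da (k x * a x) x)
    (hpos : ∃ x ∈ Icc x₁ x₂, 0 < a x) :
    ¬ (a x₁ = 0 ∧ da x₁ = 0) := by
  rintro ⟨h₁, h₁'⟩
  obtain ⟨x, hx, hax⟩ := hpos
  have := (envelope_eq_zero_of_cauchy_right hk ha hda h₁ h₁' x hx).1
  linarith

/-- No exact landing: an envelope that is positive somewhere on `[x₁, x₂]` cannot have
`a(x₂) = a'(x₂) = 0` — at finite `n` the envelope never reaches the neutral leaf with zero value
and zero slope; it overshoots with a tail (paper §24.60(5)). -/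
theorem no_exact_landing
    {k a da : ℝ → ℝ} {x₁ x₂ M : ℝ}
    (hk : ∀ x ∈ Icc x₁ x₂, |k x| ≤ M)
    (ha : ∀ x ∈ Icc x₁ x₂, HasDerivAt a (da x) x)
    (hda : ∀ x ∈ Icc x₁ x₂, HasDerivAt da (k x * a x) x)
    (hpos : ∃ x ∈ Icc x₁ x₂, 0 < a x) :
    ¬ (a x₂ = 0 ∧ da x₂ = 0) := by
  rintro ⟨h₂, h₂'⟩
  obtain ⟨x, hx, hax⟩ := hpos
  have := (envelope_eq_zero_of_cauchy_left hk ha hda h₂ h₂' x hx).1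
  linarith

/-- Packaging for the reduced model: with `k = -W/(γ h²)` and `|W| ≤ W₀` along the state, the
bound `|k| ≤ W₀/(γ h²)` holds, so both exclusions apply at every finite `n` (`h = 1/n > 0`). -/
theorem envelope_coeff_bound {W : ℝ → ℝ} {γ h W₀ x₁ x₂ : ℝ} (hγ : 0 < γ) (hh : 0 < h)
    (hW : ∀ x ∈ Icc x₁ x₂, |W x| ≤ W₀) :
    ∀ x ∈ Icc x₁ x₂, |(-W x / (γ * h ^ 2))| ≤ W₀ / (γ * h ^ 2) := by
  intro x hx
  have hpos : 0 < γ * h ^ 2 := by positivity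
  rw [abs_div, abs_neg, abs_of_pos hpos]
  exact div_le_div_of_nonneg_right (hW x hx) hpos.le

end Summit.AnomalousDissipation.AnomalousDissipation.Theorems
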